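import Summits.BirchSwinnertonDyer.BirchSwinnertonDyer.Theses.KolyvaginRankRigidityAtTwo
import Summits.BirchSwinnertonDyer.BirchSwinnertonDyer.Theorems.KolyvaginRankRigidityAtTwoAdmissibleAtTwo
import Summits.BirchSwinnertonDyer.BirchSwinnertonDyer.Theorems.ErratumRoadFiveNonSurjCornerKolyJProp44StandingInputs
import Summits.BirchSwinnertonDyer.BirchSwinnertonDyer.Theorems.ErratumRoadFiveNonSurjCornerKolyJLevelOneAvatar
import Summits.BirchSwinnertonDyer.BirchSwinnertonDyer.Theorems.ErratumRoadFiveShimuraKolyvaginOrderBoundInertCarrierEuler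
import Summits.BirchSwinnertonDyer.BirchSwinnertonDyer.Theorems.KolyvaginRankRigidityAtTwoClassesIntoSelmerGood
import Literature.NumberTheory.EllipticCurves.SelmerTorsionInclusion
import Literature.NumberTheory.EllipticCurves.SelmerLevelToPrimary
import HarnessLib

/-!
# Crux V2♭θ `KolyvaginCorankLowerBoundAtTwoTheta` (stmt-BirchSwinnertonDyer-27220; also V2♭ₘ 27015), line
# `kolyvagin_depth_split`, registered stub S4 `stub_globalOrderLevelUpAtTwo` — CLOSED:
# global orders of Kolyvagin classes go UP with the level

`ι_* c_M(n) = 2^{M'-M} · c_{M'}(n)` for the change-of-level map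
`ι_* : H¹(K, E[2^M]) → H¹(K, E[2^{M'}])` (McCallum 1991 §4 (4)–(6), Lemma 4.6: the classes of `P(n)` at
the two levels are represented by cocycles with the same roots; tree:
`Koly.torsionH1OfDvd_kolyvaginClass_of_zsmul`, `Theorems.kolyvaginClass_zsmul_add_zsmul_eq`), and
`ι_*` is injective on the habitat because `H¹(K, E[2^M]) → H¹(K, E[2^∞])` is
(`torsionPowToPrimaryH1_two_injective_of_hasSurjectiveModNGaloisRep`, `E(K̄)[2^∞]^{Γ_K} = 0` from the
surjective mod-`2` image over the quadratic `K`). Hence `2^j c_M(n) ≠ 0 ⇒ 2^{j+M'-M} c_{M'}(n) ≠ 0` for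
`M ≤ M' ≤ M(n)` — hypothesis `hglobUp` of the landed `windowsTheta_of_swap` (p619681), verbatim the
registered stub. The standing inputs of McCallum's class at level `2^{M'}` (admissibility, Gross
Lemma 4.3 at `2`: `KolyvaginAtTwo.isAdmissible_pointsSubgroup_two_of_heegner`; invariance of `[P(n)]`,
Gross Prop. 3.6: `Prop44.toGeomPoints_derivedPoint_mem_invPoints`) are theorems on the habitat.
HONEST FRAMING: bookkeeping only; nothing here proves V2♭ₘ or BSD.
-/

set_option autoImplicit false
-- the Theorems namespace of this sub repeats the summit name by design (D-0017 nested layout)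
set_option linter.dupNamespace false

noncomputable section

open scoped Classical

open WeierstrassCurve Field Literature.NumberTheory.EllipticCurves
  Literature.NumberTheory.EllipticCurves.ModularForms NumberField IsDedekindDomain
  Literature.NumberTheory.EllipticCurves.KolyvaginCocycle
  Literature.NumberTheory.GaloisRepresentations
open Summit.BirchSwinnertonDyer.BirchSwinnertonDyer.Theses.KolyvaginRankRigidityAtTwo

namespace Summit.BirchSwinnertonDyer.BirchSwinnertonDyer.Theorems.KolyvaginLowerBoundAtTwo

/-- **`H¹(K, E[2^M]) → H¹(K, E[2^{M'}]) → H¹(K, E[2^∞])` is `H¹(K, E[2^M]) → H¹(K, E[2^∞])`**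
(functoriality of `H¹` in the coefficients: both are the map of the pair `(id, E[2^M] ↪ E[2^∞])`).
[cite: SerreGaloisCohomology1997, I.§2.4] -/
theorem torsionPowToPrimaryH1_comp_torsionH1OfDvd {K : Type} [Field K] (W : WeierstrassCurve K)
    {M M' : ℕ} (h : ((2 ^ M : ℕ) : ℤ) ∣ ((2 ^ M' : ℕ) : ℤ)) :
    (torsionPowToPrimaryH1 W 2 M').comp (torsionH1OfDvd W h) = torsionPowToPrimaryH1 W 2 M := by
  unfold torsionPowToPrimaryH1 torsionH1OfDvd
  rw [resH1Hom_comp]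
  exact resH1Hom_congr rfl (AddMonoidHom.ext fun _ ↦ rfl) _ _

/-- **`ι_* : H¹(K, E[2^M]) → H¹(K, E[2^{M'}])` is injective on the habitat** (`K` quadratic,
`ρ̄_{E,2}` onto): it is followed by `H¹(K, E[2^{M'}]) → H¹(K, E[2^∞])` to give the injective
`H¹(K, E[2^M]) → H¹(K, E[2^∞])` (Zhang 2014, p. 248). [cite: WZhang2014, p. 248] -/
theorem torsionH1OfDvd_two_pow_injective (W : WeierstrassCurve ℚ) [W.IsElliptic] {K : Type}
    [Field K] [NumberField K] (hK : Module.finrank ℚ K = 2) (hs : W.HasSurjectiveModNGaloisRep 2)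
    {M M' : ℕ} (h : ((2 ^ M : ℕ) : ℤ) ∣ ((2 ^ M' : ℕ) : ℤ)) :
    Function.Injective (torsionH1OfDvd (W.baseChange K) h) := by
  intro x y hxy
  apply KolyvaginRankRigidity.torsionPowToPrimaryH1_two_injective_of_hasSurjectiveModNGaloisRep W hK hs M
  rw [← torsionPowToPrimaryH1_comp_torsionH1OfDvd (W.baseChange K) h, AddMonoidHom.comp_apply,
    AddMonoidHom.comp_apply, hxy]

/-- **`ι_* c_M(n) = 2^{M'-M} · c_{M'}(n)`** for a Kolyvagin–Heegner datum whose class at level `2^M`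
is McCallum's class (not the junk value) and whose standing inputs hold at level `2^{M'}`
(`M ≤ M'`): the two classes are represented by cocycles with the same roots (McCallum §4 (4)–(6),
Lemma 4.6). [cite: McCallumLMS1991, §4 (4)–(6), Lemma 4.6] [cite: GrossLMS1991, §4 (4.4), (4.6)] -/
theorem torsionH1OfDvd_kolyvaginClass_two_pow {K : Type} [Field K] [NumberField K]
    {W : WeierstrassCurve ℚ} [NeZero (W.conductorNorm ℤ)]
    {Dt : ModularParametrizationData W (W.conductorNorm ℤ)} {β : ℤ} {ι : K →+* ℂ} {n : ℕ}
    (d : KolyvaginHeegnerData Dt β ι n) {M M' : ℕ} (hMM' : M ≤ M')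
    (hA : IsAdmissible (absoluteGaloisGroup K) d.pointsSubgroup ((2 ^ M : ℕ) : ℤ))
    (hP : d.toGeomPoints d.derivedPoint ∈
      invPoints (absoluteGaloisGroup K) d.pointsSubgroup ((2 ^ M : ℕ) : ℤ))
    (hA' : IsAdmissible (absoluteGaloisGroup K) d.pointsSubgroup ((2 ^ M' : ℕ) : ℤ))
    (hP' : d.toGeomPoints d.derivedPoint ∈
      invPoints (absoluteGaloisGroup K) d.pointsSubgroup ((2 ^ M' : ℕ) : ℤ)) :
    torsionH1OfDvd (W.baseChange K)
        (by exact_mod_cast pow_dvd_pow 2 hMM' : ((2 ^ M : ℕ) : ℤ) ∣ ((2 ^ M' : ℕ) : ℤ))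
        (d.kolyvaginClass Nat.prime_two M) =
      ((2 ^ (M' - M) : ℕ) : ℤ) • d.kolyvaginClass Nat.prime_two M' := by
  have hdivM := (W.baseChange K).zsmul_geomPoints_surjective_of_charZero (n := ((2 ^ M : ℕ) : ℤ))
    (by exact_mod_cast pow_ne_zero M Nat.prime_two.ne_zero)
  have hdivM' := (W.baseChange K).zsmul_geomPoints_surjective_of_charZero (n := ((2 ^ M' : ℕ) : ℤ))
    (by exact_mod_cast pow_ne_zero M' Nat.prime_two.ne_zero)
  have hnm : ((2 ^ M' : ℕ) : ℤ) = ((2 ^ (M' - M) : ℕ) : ℤ) * ((2 ^ M : ℕ) : ℤ) := by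
    rw [← Nat.cast_mul, ← pow_add, Nat.sub_add_cancel hMM']
  -- the multiple `2^{M'-M} • P(n)` is invariant mod `2^{M'}`
  have hPm : ((2 ^ (M' - M) : ℕ) : ℤ) • d.toGeomPoints d.derivedPoint ∈
      invPoints (absoluteGaloisGroup K) d.pointsSubgroup ((2 ^ M' : ℕ) : ℤ) :=
    (invPoints _ _ _).zsmul_mem hP' _
  rw [d.kolyvaginClass_of_admissible Nat.prime_two M hA hP,
    d.kolyvaginClass_of_admissible Nat.prime_two M' hA' hP',
    Summit.BirchSwinnertonDyer.Rank1Residual.X11b.Three.Koly.torsionH1OfDvd_kolyvaginClass_of_zsmul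
      (W.baseChange K) _ hnm hdivM hdivM' hA hA' hP rfl hPm]
  -- `c(u • P + 2^{M'} • 0) = u • c(P)`
  have hP'' : ((2 ^ (M' - M) : ℕ) : ℤ) • d.toGeomPoints d.derivedPoint + ((2 ^ M' : ℕ) : ℤ) • (0 :
      geomPoints (W.baseChange K)) ∈
      invPoints (absoluteGaloisGroup K) d.pointsSubgroup ((2 ^ M' : ℕ) : ℤ) := by
    simpa using hPm
  have h := Summit.BirchSwinnertonDyer.BirchSwinnertonDyer.Theorems.kolyvaginClass_zsmul_add_zsmul_eq
    (W := W) (hdiv := hdivM') hA' hP' ((2 ^ (M' - M) : ℕ) : ℤ) d.pointsSubgroup.zero_mem hP''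
  rw [← h]
  congr 1
  simp

/-- **S4 `stub_globalOrderLevelUpAtTwo` — CLOSED** (registered stub of the lead's skeleton for
crux 27015, = hypothesis `hglobUp` of `windowsTheta_of_swap`, p619681): on V2♭ₘ's habitat and frame,
for a Kolyvagin conductor `n` and levels `1 ≤ M ≤ M' ≤ M(n)`,
`2^j c_M(n) ≠ 0 ⇒ 2^{j + (M'-M)} c_{M'}(n) ≠ 0`.
[cite: McCallumLMS1991, §4 (4)–(6), Lemma 4.6] [cite: WZhang2014, p. 248] -/
theorem stub_globalOrderLevelUpAtTwo :
    ∀ (W : WeierstrassCurve ℚ) [W.IsElliptic] [W.IsGloballyMinimal], ¬ W.HasCM →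
      (Rank1Residual.GoodOrd W 2 ∨ Rank1Residual.Mult W 2) →
      (∀ m : ℕ, W.HasSurjectiveModNGaloisRep (2 ^ m : ℕ)) →
      ∀ (K : Type) [Field K] [NumberField K], IsImaginaryQuadratic K → NumberField.discr K ≠ -3 →
      NumberField.discr K ≠ -4 → ¬ ((2 : ℤ) ∣ NumberField.discr K) → ∀ [NeZero (W.conductorNorm ℤ)],
      SatisfiesHeegnerHypothesis (W.conductorNorm ℤ) K →
      ∀ (Dt : ModularParametrizationData W (W.conductorNorm ℤ)) (β : ℤ) (ι : K →+* ℂ),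
        ∀ (n : ℕ) (dat : KolyvaginHeegnerData Dt β ι n) (M M' j : ℕ),
          KolyvaginDescent.KolSupp (Zhang2014.IsKolyvaginPrime (W.conductorNorm ℤ) W K 2) n →
          1 ≤ M → M ≤ M' → (M' : ℕ∞) ≤ Zhang2014.levelIndex W 2 n →
          ((2 ^ j : ℕ) : ℤ) • dat.kolyvaginClass Nat.prime_two M ≠ 0 →
          ((2 ^ (j + (M' - M)) : ℕ) : ℤ) • dat.kolyvaginClass Nat.prime_two M' ≠ 0 := by
  intro W _ _ _ _ hsur K _ _ hK hne3 hne4 h2d _ hHN Dt β ι n dat M M' j hn _ hMM' hlev hne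
  have hD : NumberField.discr K < -4 :=
    Summit.BirchSwinnertonDyer.Rank1Residual.X11b.KolyvaginAssembly.discr_lt_neg_four hK ⟨hne3, hne4⟩
  have hodd : Odd (NumberField.discr K) :=
    Int.not_even_iff_odd.mp fun h ↦ h2d (even_iff_two_dvd.mp h)
  have hs2 : W.HasSurjectiveModNGaloisRep 2 := by simpa using hsur 1
  have hn0 : n ≠ 0 := hn.1.ne_zero
  -- the class at level `M` is McCallum's class (it is non-zero)
  have hne0 : dat.kolyvaginClass Nat.prime_two M ≠ 0 := fun h ↦ hne (by rw [h, zsmul_zero])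
  obtain ⟨hA, hP⟩ := dat.kolyvaginClass_ne_zero hne0
  -- the standing inputs at level `M'` on the habitat
  have hA' : IsAdmissible (absoluteGaloisGroup K) dat.pointsSubgroup ((2 ^ M' : ℕ) : ℤ) :=
    KolyvaginAtTwo.isAdmissible_pointsSubgroup_two_of_heegner dat hs2 hK hodd hHN hn0 M'
  have hkol : ∀ q ∈ n.primeFactors, Zhang2014.IsKolyvaginPrime (W.conductorNorm ℤ) W K 2 q ∧
      M' ≤ Zhang2014.kolyvaginIndex W 2 q :=
    fun q hq ↦ ⟨hn.2 q hq, (Zhang2014.natCast_le_levelIndex_iff.mp hlev) q hq⟩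
  have hP' : dat.toGeomPoints dat.derivedPoint ∈
      invPoints (absoluteGaloisGroup K) dat.pointsSubgroup ((2 ^ M' : ℕ) : ℤ) :=
    Prop44.toGeomPoints_derivedPoint_mem_invPoints hK ι hD hHN Dt Nat.prime_two hn.1 hkol dat
  -- `ι_* (2^j c_M) = 2^j 2^{M'-M} c_{M'}`, and `ι_*` is injective
  have hdvd : ((2 ^ M : ℕ) : ℤ) ∣ ((2 ^ M' : ℕ) : ℤ) := by exact_mod_cast pow_dvd_pow 2 hMM'
  have hinj := torsionH1OfDvd_two_pow_injective W hK.1 hs2 hdvd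
  intro h0
  apply hne
  apply hinj
  rw [map_zero, map_zsmul, torsionH1OfDvd_kolyvaginClass_two_pow dat hMM' hA hP hA' hP', smul_smul,
    ← Nat.cast_mul, ← pow_add]
  exact h0

end Summit.BirchSwinnertonDyer.BirchSwinnertonDyer.Theorems.KolyvaginLowerBoundAtTwo

end
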